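import Literature.NumberTheory.EllipticCurves.TwistedThreeKernelTransport
import HarnessLib

/-!
# The `3`-isogeny `φ : y² = x³ + k → Y² = X³ − 27k` over `ℚ` for NON-SQUARE `k` (twisted kernel `{O, (0, ±√k)}`), and
# «`Ш(E/ℚ) ∩ ker φ_* = 0` from the box over the Kummer field» for Mordell curves (Silverman X.4.2 (a); Cohen–Pazuki 2009 Prop. 2.2)

Topic `NumberTheory/EllipticCurves`. Sequel of `TwistedThreeKernelTransport`, Mordell-curve specialisation. The tree's Vélu pair
`IsVeluThreePair 0 s` (`ThreeIsogeny`) needs the kernel ordinate `s = √k` IN THE BASE FIELD; for the Mordell curve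
`E = mordellCurve k : y² = x³ + k` over a field `K` with `k ∉ K*²` (e.g. the Sylvester twists `y² = x³ − 2p²` over `ℚ`) the pair lives over
`K̄` with `s ∈ K̄`, `s² = k`, and is nevertheless DEFINED OVER `K` because Vélu's formulas
`X = (x³ + 4s²)/x²`, `Y = y(x³ − 8s²)/x³` involve only `s² = k`:

* §1 `isVeluThreePair_of_sq_eq` — `(E_K̄, E'_K̄)`, `E' = mordellCurve (−27k)`, is the Vélu pair with parameters `(0, s)` for ANY
  `s ∈ K̄` with `s² = k`; `pointHom_smul_of_sq_eq` — its map on `E(K̄)` commutes with `Γ_K`; kernel `{O, ±(0, s)}`, onto.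
* §2 for `K = ℚ` and a `μ₃`-kernel datum `𝒯` on `E_L` with `𝒯.T = (0, y₀)`: the transported point is `T = (0, s)` with `ι s = y₀`
  (`exists_transport_eq_some_zero`), so §1 applies with THIS `s`;
* §3 ★★ `eq_zero_of_mem_sha_of_galH1Map_eq_zero_mordell` — for `E = y² = x³ + k` over `ℚ`, a Kummer field `L` as in
  `TwistedKummerCharacterNorm` (Galois, `3 ∤ [L:ℚ]`, `√−3 ∉ L`, involution `c`, lift `c̄` negating `√−3`), a `μ₃`-kernel datum `𝒯` on
  `E_L` with `𝒯.T = (0, y₀)`, `c̄ y₀ = y₀`: if the norm-cube `L`-box is sharp then `Ш(E/ℚ) ∩ ker φ_* = 0` for the Vélu `3`-isogeny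
  `φ` with kernel `{O, ±T}`, `T` the transport of `𝒯.T`.

What is NOT here: the boxes (S-units, local images), the `φ̂`-side and the assembly to `rank = 0 ∧ Ш[3] = 0` (programme memo
`Summits/BirchSwinnertonDyer/BirchSwinnertonDyer/Cruxes/HeegnerTwistCouplingInSupply/TWISTED-DESCENT-PROGRAMME-w4g32.md`).
Everything here is proved; no definitions, no named facts.

## References

* [SilvermanAEC2009] J. H. Silverman, *AEC*, III.4.12–4.13 (isogenies defined over `K`), Thm. X.4.2 (a).
* [CohenPazuki2009] H. Cohen, F. Pazuki, Acta Arith. 140 (2009), §1 (the `3`-isogeny of `y² = x³ + D(ax+b)²`), Prop. 2.2.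
* [CremonaAlgorithms1997] J. E. Cremona, *Algorithms for Modular Elliptic Curves*, §3.8 (Vélu's formulae).
* Tree: `ThreeIsogeny` (`IsVeluThreePair`, `pointFun`, `pointFun_eq_zero_iff`), `ThreeIsogenyKernelX` (`pointFun_surjective`),
  `MordellCurveThreeDescent` (`mordellCurve`, `smul_geomPoints_some`, `nonsingular_galAut`), `TwistedThreeKernelTransport`.
-/

noncomputable section

open scoped Classical

namespace Literature.NumberTheory.EllipticCurves

namespace TwistedKummer

open _root_.WeierstrassCurve GaloisRepresentations MordellDescent CPMuDescent

universe u

/-! ## §1 The Vélu pair of `y² = x³ + k` over `K̄` with `s = √k`, defined over `K` -/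

section Velu

variable {K : Type u} [Field K] [CharZero K] {k : K} (hk : k ≠ 0) {s : AlgebraicClosure K}
  (hs : s ^ 2 = algebraMap K (AlgebraicClosure K) k)

include hk hs in
/-- **`(E_K̄, E'_K̄)` is the Vélu three-pair with parameters `(0, s)`** for `E = y² = x³ + k`, `E' = Y² = X³ − 27k` and any `s ∈ K̄`
with `s² = k`. [cite: CremonaAlgorithms1997, §3.8] -/
theorem isVeluThreePair_of_sq_eq :
    IsVeluThreePair (0 : AlgebraicClosure K) s ((mordellCurve k).baseChange (AlgebraicClosure K))
      ((mordellCurve (-27 * k)).baseChange (AlgebraicClosure K)) where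
  a₁_eq := by rw [mordellCurve_baseChange]; rfl
  a₂_eq := by rw [mordellCurve_baseChange, mordellCurve_a₂]; ring
  a₃_eq := by rw [mordellCurve_baseChange]; rfl
  a₄_eq := by rw [mordellCurve_baseChange, mordellCurve_a₄]; ring
  a₆_eq := by rw [mordellCurve_baseChange, mordellCurve_a₆, hs]
  a₁'_eq := by rw [mordellCurve_baseChange]; rfl
  a₂'_eq := by rw [mordellCurve_baseChange, mordellCurve_a₂]; ring
  a₃'_eq := by rw [mordellCurve_baseChange]; rfl
  a₄'_eq := by rw [mordellCurve_baseChange, mordellCurve_a₄]; ring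
  a₆'_eq := by rw [mordellCurve_baseChange, mordellCurve_a₆, map_mul, map_neg, map_ofNat, hs]; ring
  Δ_ne := by
    rw [mordellCurve_baseChange, mordellCurve_Δ, neg_ne_zero]
    refine mul_ne_zero (by norm_num) (pow_ne_zero 2 ?_)
    rwa [map_ne_zero_iff _ (algebraMap K (AlgebraicClosure K)).injective]

include hs in
omit [CharZero K] in
/-- `Γ_K` preserves `s² = k`: `(σ s)² = s²`. [cite: SilvermanAEC2009, III.4.12–4.13] -/
theorem galAut_sq_eq (σ : Field.absoluteGaloisGroup K) : galAut σ s ^ 2 = s ^ 2 := by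
  rw [← map_pow, hs, AlgEquiv.commutes]

/-- **The `3`-isogeny with twisted kernel is defined over `K`**: for a Vélu pair over `K̄` with parameters `(0, s)`, `s² ∈ K`, the map on
points commutes with `Γ_K` (Vélu's formulas `X = (x³ + 4s²)/x²`, `Y = y(x³ − 8s²)/x³` only involve `s²`).
[cite: SilvermanAEC2009, III.4.12–4.13 (Remark 4.13.2)] -/
theorem pointHom_smul_of_sq_eq {W W' : WeierstrassCurve K}
    (hV : IsVeluThreePair (0 : AlgebraicClosure K) s (W.baseChange (AlgebraicClosure K)) (W'.baseChange (AlgebraicClosure K)))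
    (hs : s ^ 2 = algebraMap K (AlgebraicClosure K) k) (σ : Field.absoluteGaloisGroup K) (P : geomPoints W) :
    (show geomPoints W →+ geomPoints W' from hV.pointHom) (σ • P) =
      σ • (show geomPoints W →+ geomPoints W' from hV.pointHom) P := by
  set τ : AlgebraicClosure K →ₐ[K] AlgebraicClosure K :=
    ((show AlgebraicClosure K ≃ₐ[K] AlgebraicClosure K from σ) :
      AlgebraicClosure K →ₐ[K] AlgebraicClosure K) with hτ
  have hτs : τ s ^ 2 = s ^ 2 := galAut_sq_eq hs σ
  rcases P with _ | ⟨x, y, hxy⟩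
  · show (show geomPoints W →+ geomPoints W' from hV.pointHom) (σ • (0 : W.geomPoints)) =
      σ • (show geomPoints W →+ geomPoints W' from hV.pointHom) 0
    rw [smul_zero, map_zero, smul_zero]
  · show hV.pointFun (Affine.Point.map τ (Affine.Point.some x y hxy)) =
      Affine.Point.map τ (hV.pointFun (Affine.Point.some x y hxy))
    rw [Affine.Point.map_some]
    by_cases hx : x = 0
    · have hσx : τ x = 0 := by rw [hx, map_zero]
      rw [hV.pointFun_some_of_eq_zero _ hσx, hV.pointFun_some_of_eq_zero _ hx, Affine.Point.map_zero]
    · have hσx : τ x ≠ 0 := (map_ne_zero τ).mpr hx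
      rw [hV.pointFun_some _ hσx, hV.pointFun_some _ hx, Affine.Point.map_some]
      refine point_some_ext ?_ ?_
      · simp only [IsVeluThreePair.X, map_div₀, map_add, map_pow, map_mul, map_ofNat, mul_zero, zero_mul, add_zero]
        rw [hτs]
      · simp only [IsVeluThreePair.Y, map_div₀, map_sub, map_pow, map_mul, map_ofNat, mul_zero, zero_mul, sub_zero]
        rw [hτs]

/-- The Vélu map as an additive homomorphism on geometric points commuting with `Γ_K`, with kernel `{O, ±T}` and onto: the data
`(f, hf, hsurj, hker)` consumed by `TwistedThreeKernelTransport`. [cite: SilvermanAEC2009, Thm. X.4.2 (a)] -/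
theorem exists_hom_of_sq_eq {W W' : WeierstrassCurve K}
    (hV : IsVeluThreePair (0 : AlgebraicClosure K) s (W.baseChange (AlgebraicClosure K)) (W'.baseChange (AlgebraicClosure K)))
    (hs : s ^ 2 = algebraMap K (AlgebraicClosure K) k) :
    ∃ (f : geomPoints W →+ geomPoints W')
      (_ : ∀ (σ : Field.absoluteGaloisGroup K) (P : geomPoints W), f (σ • P) = σ • f P),
      (∀ P, f P = hV.pointFun P) ∧ Function.Surjective f ∧ f hV.T = 0 ∧
        ∀ P : geomPoints W, f P = 0 → P = 0 ∨ P = hV.T ∨ P = -hV.T := by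
  refine ⟨hV.pointHom, fun σ P => pointHom_smul_of_sq_eq hV hs σ P, fun P => rfl, hV.pointFun_surjective, hV.pointFun_T,
    fun P hP => ?_⟩
  exact (hV.pointFun_eq_zero_iff P).mp hP

end Velu

/-! ## §2 Over `ℚ`: the transported point has abscissa `0` -/

section TransportZero

variable {L : Type} [Field L] [NumberField L] {E : WeierstrassCurve ℚ} {𝒯 : MuThreeKernel (E.baseChange L)}
  {T : geomPoints E} (hT : localPointsEquivGeomPoints E L (pointsMap E L T) = 𝒯.T)
include hT

/-- If `𝒯.T = (x₀, y₀)` then the transported point is `T = (x, y)` with `ι x = x₀`, `ι y = y₀`. [cite: SilvermanAEC2009, App. B §2] -/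
theorem exists_transport_eq_some {x₀ y₀ : AlgebraicClosure L}
    {h₀ : ((E.baseChange L).baseChange (AlgebraicClosure L)).toAffine.Nonsingular x₀ y₀}
    (hTc : 𝒯.T = Affine.Point.some x₀ y₀ h₀) :
    ∃ (x y : AlgebraicClosure ℚ) (h : (E.baseChange (AlgebraicClosure ℚ)).toAffine.Nonsingular x y),
      T = Affine.Point.some x y h ∧ iotaE (K := ℚ) L x = x₀ ∧ iotaE (K := ℚ) L y = y₀ := by
  have hT0 := transport_ne_zero hT
  revert hT
  rcases T with _ | ⟨x, y, hxy⟩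
  · exact absurd rfl hT0
  · intro hT
    have e := hT
    change Affine.Point.congrEquiv (baseChange_baseChange E L (AlgebraicClosure L)).symm
      (Affine.Point.map (iotaE (K := ℚ) L) (Affine.Point.some x y hxy)) = _ at e
    rw [Affine.Point.map_some, Affine.Point.congrEquiv_some, hTc] at e
    simp only [Affine.Point.some.injEq] at e
    exact ⟨x, y, hxy, rfl, e.1, e.2⟩

/-- In particular if `𝒯.T = (0, y₀)` then `T = (0, s)` with `ι s = y₀`. [cite: SilvermanAEC2009, App. B §2] -/
theorem exists_transport_eq_some_zero {y₀ : AlgebraicClosure L}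
    {h₀ : ((E.baseChange L).baseChange (AlgebraicClosure L)).toAffine.Nonsingular 0 y₀}
    (hTc : 𝒯.T = Affine.Point.some 0 y₀ h₀) :
    ∃ (s : AlgebraicClosure ℚ) (h : (E.baseChange (AlgebraicClosure ℚ)).toAffine.Nonsingular 0 s),
      T = Affine.Point.some 0 s h ∧ iotaE (K := ℚ) L s = y₀ := by
  obtain ⟨x, y, h, hTeq, hx, hy⟩ := exists_transport_eq_some hT hTc
  have hx0 : x = 0 :=
    (iotaE (K := ℚ) L).injective (show iotaE (K := ℚ) L x = iotaE (K := ℚ) L 0 by rw [hx, map_zero])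
  subst hx0
  exact ⟨y, h, hTeq, hy⟩

end TransportZero

/-! ## §3 `Ш(E/ℚ) ∩ ker φ_* = 0` for Mordell curves from the box over the Kummer field -/

/-- For a geometric point `(0, s)` of `y² = x³ + k`: `s² = k`. [cite: SilvermanAEC2009, X.§4] -/
theorem sq_eq_of_nonsingular_zero {k : ℚ} {s : AlgebraicClosure ℚ}
    (h : ((mordellCurve k).baseChange (AlgebraicClosure ℚ)).toAffine.Nonsingular 0 s) :
    s ^ 2 = algebraMap ℚ (AlgebraicClosure ℚ) k := by
  have he := h.left
  rw [mordellCurve_baseChange, mordellCurve_equation_iff] at he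
  linear_combination he


section Mordell

variable {L : Type} [Field L] [NumberField L] [IsGalois ℚ L] (c : L ≃+* L) (hc2 : ∀ x : L, c (c x) = x)
  (cbar : AlgebraicClosure L ≃+* AlgebraicClosure L)
  (hcbar : ∀ x : L, cbar (algebraMap L (AlgebraicClosure L) x) = algebraMap L (AlgebraicClosure L) (c x))
  (hθ : cbar (theta L) = -theta L)
include hc2 hcbar hθ

/-- ★★ **`Ш(E/ℚ) ∩ ker φ_* = 0` for `E : y² = x³ + k` from the sharp norm-cube box over the Kummer field `L`.** Data: `k ∈ ℚ*`;
`L` Galois over `ℚ` with `3 ∤ [L : ℚ]`, `√−3 ∉ L`, an involution `c`, a lift `c̄` negating `√−3`; a `μ₃`-kernel datum `𝒯` on `E_L`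
with `𝒯.T = (0, y₀)`, `c̄ y₀ = y₀` (for `L = ℚ(√−3k)`, `𝒯 =` the Mordell datum, `y₀ = (λ/3)√−3`, `λ² = −3k`, `cλ = −λ`); the
transported point `T = (0, s)` and the Vélu pair `hV` with parameter `s` (§1–§2: they exist). If every `[C_u] ∈ Ш(E_L/L)` with
`u·c(u)` a `c`-fixed non-zero cube vanishes, then for the `3`-isogeny `φ = hV.pointFun : E(ℚ̄) → E'(ℚ̄)` (`E' = Y² = X³ − 27k`), every
`c₀ ∈ Ш(E/ℚ)` with `φ_* c₀ = 0` is `0`. [cite: CohenPazuki2009, Proposition 2.2] [cite: SilvermanAEC2009, Thm. X.4.2 (a)] -/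
theorem eq_zero_of_mem_sha_of_galH1Map_eq_zero_mordell (hL : ∀ q : L, q ^ 2 ≠ -3)
    (hdeg : Nat.Coprime 3 (Module.finrank ℚ L)) {k : ℚ}
    (𝒯 : MuThreeKernel ((mordellCurve k).baseChange L))
    {y₀ : AlgebraicClosure L} {h₀ : (((mordellCurve k).baseChange L).baseChange (AlgebraicClosure L)).toAffine.Nonsingular 0 y₀}
    (hTc : 𝒯.T = Affine.Point.some 0 y₀ h₀) (hy : cbar y₀ = y₀)
    {T : geomPoints (mordellCurve k)} (hT : localPointsEquivGeomPoints (mordellCurve k) L (pointsMap (mordellCurve k) L T) = 𝒯.T)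
    {s : AlgebraicClosure ℚ} {hs0 : ((mordellCurve k).baseChange (AlgebraicClosure ℚ)).toAffine.Nonsingular 0 s}
    (hTs : T = Affine.Point.some 0 s hs0)
    (hV : IsVeluThreePair (0 : AlgebraicClosure ℚ) s ((mordellCurve k).baseChange (AlgebraicClosure ℚ))
      ((mordellCurve (-27 * k)).baseChange (AlgebraicClosure ℚ)))
    (f : geomPoints (mordellCurve k) →+ geomPoints (mordellCurve (-27 * k)))
    (hf : ∀ (σ : Field.absoluteGaloisGroup ℚ) (P : geomPoints (mordellCurve k)), f (σ • P) = σ • f P)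
    (hfV : ∀ P, f P = hV.pointFun P)
    (hbox : ∀ {u : L} (hu : u ≠ 0), (∃ r : L, c r = r ∧ r ≠ 0 ∧ u * c u = r ^ 3) →
      𝒯.torsorClass hu ∈ ((mordellCurve k).baseChange L).sha → 𝒯.torsorClass hu = 0)
    {c₀ : (mordellCurve k).galH1} (hc₀ : c₀ ∈ (mordellCurve k).sha) (h0 : galH1Map f hf c₀ = 0) : c₀ = 0 := by
  have hTV : hV.T = T := by rw [hTs]; exact point_some_ext rfl rfl
  have hsurj : Function.Surjective f := by
    intro Q; obtain ⟨P, hP⟩ := hV.pointFun_surjective Q; exact ⟨P, by rw [hfV, hP]⟩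
  have hfT : f T = 0 := by rw [hfV, ← hTV]; exact hV.pointFun_T
  have hker : ∀ P : geomPoints (mordellCurve k), f P = 0 → P = 0 ∨ P = T ∨ P = -T := by
    intro P hP
    rw [hfV] at hP
    rw [← hTV]
    exact (hV.pointFun_eq_zero_iff P).mp hP
  exact eq_zero_of_mem_sha_of_galH1Map_eq_zero_of_box_transport c hc2 cbar hcbar hθ hL hdeg 𝒯 hT hTc (map_zero cbar) hy
    f hf hsurj hfT hker hbox hc₀ h0

end Mordell

end TwistedKummer

end Literature.NumberTheory.EllipticCurves

end
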